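import Literature.Probability.RandomPlanarGeometry.SAWPulledLargeForceExpansionZdSixStep
import Literature.Probability.RandomPlanarGeometry.SAWPulledLargeForceExpansionZdSevenStep
import Literature.Probability.RandomPlanarGeometry.SAWIrreducibleBridgeSpanOne
import HarnessLib

/-!
# The self-avoiding-walk counts `c₃(ℤ^d) = 2d(2d−1)²`, `c₄(ℤ^d) = 2d(2d−1)³ − 2d(2d−2)`, `c₅(ℤ^d) = 2d(2d−1)⁴ − 2d(2d−2)(4d−3)`,
# `c₆(ℤ^d) = 64d⁶ − 160d⁵ + 112d⁴ + 20d² − 34d` in every dimension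

Topic `Literature/Probability/RandomPlanarGeometry` (combines `SAWIrreducibleBridgeSpanOne.lean`: `costCoeffZd d c (c+1) = count d c`, with the
cost censuses of `SAWPulledLargeForceExpansionZdThirdOrder` (`N_{3,4}`), `…ZdFourthOrder` (`N_{4,5}`), `…ZdSixStep` (`N_{5,6}`),
`…ZdSevenStep` (`N_{6,7}`)).

The classical small-`n` counts of self-avoiding walks on the hypercubic lattice `ℤ^d`, as polynomials in `d`, become tree theorems for every `d`:
non-reversing words minus the unit-square closures (one square for `n = 4`; squares on steps `1–4` or `2–5` with their overlap for `n = 5`).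
Printed: `c₁ = 2d, c₂ = 2d(2d−1), c₃ = 2d(2d−1)², c₄ = 2d(2d−1)³ − 2d(2d−2)` (Madras–Slade §1.1, p. 3, ll. 7–8); the values `c₅(ℤ²) = 284`,
`c₄(ℤ³) = 726`, `c₅(ℤ³) = 3534` (Madras–Slade Appendix C, Table C.1); the `d`-polynomial of `c₅` is in the general-`d` tables of
Fisher–Gaunt (1964) / Clisby–Liang–Slade (2007), not held by the lane. [cite: MadrasSlade1993, §1.1, p. 3 (c₁–c₄ in d); Appendix C, Table C.1]

## Contents (all PROVED, standard axioms)
`count_three_eq`, `count_four_add` / `count_four_eq`, `count_five_add` / `count_five_eq`, `count_six_add` / `count_six_eq` (`d = 2, …, 6`: `780`,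
`16 926`, `127 160`, `570 330`, `1 887 492`, Madras–Slade Tables C.1/C.4). Provenance: lane «pcv-sawmu», a-p3 g16 (2026-08-24); ed.3 (+`c₆`) a-p3 g17 (2026-08-25).
-/

noncomputable section

open Literature.Probability.LatticeModels
open Literature.Probability.RandomPlanarGeometry.SAW

namespace Literature.Probability.RandomPlanarGeometry.SAW.Zd

/-- ★ `c₃(ℤ^d) = 2d(2d−1)²`. [cite: MadrasSlade1993, §1.1, p. 3] -/
theorem count_three_eq (d : ℕ) : count d 3 = 2 * d * (2 * d - 1) ^ 2 := by
  rw [← costCoeffZd_self_succ, costCoeffZd_three_four]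

/-- ★ `c₄(ℤ^d) + 2d(2d−2) = 2d(2d−1)³` (the `2d(2d−2)` unit squares among the non-reversing four-step words). [cite: MadrasSlade1993, §1.1, p. 3] -/
theorem count_four_add (d : ℕ) : count d 4 + 2 * d * (2 * d - 2) = 2 * d * (2 * d - 1) ^ 3 := by
  rw [← costCoeffZd_self_succ]; exact costCoeffZd_four_five_add d

/-- ★ `c₄(ℤ^d) = 2d(2d−1)³ − 2d(2d−2)`. [cite: MadrasSlade1993, §1.1, p. 3] -/
theorem count_four_eq (d : ℕ) : count d 4 = 2 * d * (2 * d - 1) ^ 3 - 2 * d * (2 * d - 2) := by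
  have h := count_four_add d
  omega

/-- ★ `c₅(ℤ^d) + 2d(2d−2)(4d−3) = 2d(2d−1)⁴` (squares on steps `1–4` or `2–5`, inclusion–exclusion; `d = 2, 3`: `284`, `3534`). [cite: MadrasSlade1993, Appendix C, Table C.1] -/
theorem count_five_add (d : ℕ) : count d 5 + 2 * d * (2 * d - 2) * (4 * d - 3) = 2 * d * (2 * d - 1) ^ 4 := by
  rw [← costCoeffZd_self_succ]; exact costCoeffZd_five_six_add d

/-- ★ `c₅(ℤ^d) = 2d(2d−1)⁴ − 2d(2d−2)(4d−3)` (`d = 2, 3`: `284`, `3534`). [cite: MadrasSlade1993, Appendix C, Table C.1] -/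
theorem count_five_eq (d : ℕ) : count d 5 = 2 * d * (2 * d - 1) ^ 4 - 2 * d * (2 * d - 2) * (4 * d - 3) := by
  have h := count_five_add d
  omega

/-- ★ `c₆(ℤ^d) + 160d⁵ + 34d = 64d⁶ + 112d⁴ + 20d²` (subtraction-free; `d = 2, …, 6`: `780`, `16 926`, `127 160`, `570 330`, `1 887 492`).
[cite: MadrasSlade1993, Appendix C, Table C.1 (p. 394) and Table C.4 (p. 397)] -/
theorem count_six_add (d : ℕ) : count d 6 + 160 * d ^ 5 + 34 * d = 64 * d ^ 6 + 112 * d ^ 4 + 20 * d ^ 2 := by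
  rw [← costCoeffZd_self_succ]; exact costCoeffZd_six_seven_add' d

/-- ★ `c₆(ℤ^d) = 64d⁶ − 160d⁵ + 112d⁴ + 20d² − 34d` (positive terms first, so that `ℕ`-subtraction is exact for every `d`).
[cite: MadrasSlade1993, Appendix C, Table C.1 (p. 394) and Table C.4 (p. 397)] -/
theorem count_six_eq (d : ℕ) : count d 6 = 64 * d ^ 6 + 112 * d ^ 4 + 20 * d ^ 2 - 160 * d ^ 5 - 34 * d := by
  have h := count_six_add d
  omega

end Literature.Probability.RandomPlanarGeometry.SAW.Zd

end
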